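import Mathlib.Analysis.Calculus.DerivativeTest
import Mathlib.Topology.Order.Compact
import Literature.Analysis.FluidPDE.HouTwoScaleRescaling
import HarnessLib

/-!
# The circulation exponent of Hou's self-similar profile system has a sign:
# `c_Γ = c_u + 2c_l ≥ 0` by the maximum principle for `Γ̃ = ξ² ũ₁`

Topic `Literature/Analysis/FluidPDE`. Theorems only (no definitions, no named facts), about the
tree's predicate `HouSelfSimilarProfile n ν₀ cl cu U Ω Ψ` (`HouTwoScaleRescaling.lean`: the steady
one-scale self-similar profile system of Hou, arXiv:2405.10916 §3, in the primary unknowns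
`(ũ₁, ω̃₁, ψ̃₁) = (U, Ω, Ψ)`).

## What is proved

* `HouSelfSimilarProfile.circulation_eq` — the `ũ₁`-equation of the profile system, multiplied by
  `ξ²`, is the steady rescaled **circulation equation** for `Γ̃ = ξ² ũ₁`:
  `c_l ξ Γ̃_ξ + c_l η Γ̃_η + ũ·∇Γ̃ = c_Γ Γ̃ + ν₀ (Γ̃_ξξ + ((n−4)/ξ) Γ̃_ξ + ((6−2n)/ξ²) Γ̃ + Γ̃_ηη)`
  with the **circulation exponent** `c_Γ = c_u + 2c_l` (Hou, §3: "`c_Γ = c_u + 2c_lr`", here in the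
  one-scale regime `c_lr = c_lz = c_l`; the operator `Δ̃Γ̃ = Γ̃_ξξ + ((n−4)/ξ)Γ̃_ξ + ((6−2n)/ξ²)Γ̃ + Γ̃_ηη`
  is the one displayed there and in (1.1)). The stretching term `2ũ₁ψ̃₁,η` cancels exactly against
  the radial transport `ũ^ξ = −ξψ̃₁,η` of the factor `ξ²` — the algebra of the tree's time-dependent
  `GeneralizedAxisymNS.circulation_eq_iff`, now with the two gauge terms.
* `HouSelfSimilarProfile.neg` — `(−U, Ω, Ψ)` is again a profile (the `ũ₁`-equation is linear in
  `ũ₁`, the vorticity source `(ũ₁²)_η` is even under `ũ₁ ↦ −ũ₁`).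
* **Pointwise maximum principle** (`mul_circulation_ge_of_isLocalMax`): at a point `q = (ξ, η)`,
  `ξ > 0`, where `Γ̃` has a local maximum, `(2n − 6) ν₀ ũ₁(q) ≤ c_Γ · Γ̃(q)` (for `ν₀ ≥ 0`); at a local
  minimum the reverse inequality (`mul_circulation_le_of_isLocalMin`). Hence at a POSITIVE local
  maximum (or a negative local minimum) `c_Γ ≥ (2n−6) ν₀ / ξ²`, so `c_Γ ≥ 0` when `n ≥ 3`, and
  `c_Γ > 0` when `n > 3`, `ν₀ > 0` (`circulationExponent_nonneg_of_isLocalMax`, `…_pos_…`).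
* **Global form** (`circulationExponent_nonneg_of_tendsto_zero`): if `n ≥ 3`, `ν₀ ≥ 0`, the
  circulation `Γ̃ = ξ²U` tends to `0` at infinity (Mathlib's `cocompact (ℝ × ℝ)`) and `U` is not
  identically zero off the axis, then `0 ≤ c_u + 2c_l`; with `n > 3`, `ν₀ > 0` strictly (`…_pos_…`).
  (`Γ̃` vanishes on the axis `ξ = 0` by its very form and is even in `ξ` because `U` is, so a nonzero
  value forces an interior extremum of the right sign.)
* **Exponent dictionary** (`half_le_collapseExponent`, `HouScalingExponents.half_le_hat_clz`): on the
  blow-up side `κ = −c_u > 0`, `0 ≤ c_u + 2c_l` is `ĉ_l = c_l/κ ≥ ½` — the normalized length exponent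
  of any such profile is AT LEAST the parabolic (Navier–Stokes self-similar) value `½`, with equality
  only together with non-decaying circulation at infinity (the contrapositive of the global form:
  `ĉ_l = ½` and `n > 3`, or — not proved here, strong maximum principle — `n = 3`, force `Γ̃ ↛ 0`).

## Why it is here (use)

This is the kernel form of the pen lemma "PS5-3-STRUCT / LEMMA′" of the `ns-blowup` profile cell
(zone Z5, (S) instrument; refuter K-read of 2026-08-26): every steady profile of the MODEL system
with decaying circulation has `ĉ_l ≥ ½`; the NS-admissible value `½` (constant physical viscosity,
`HouScalingExponents.physicalViscosity_eq_rpow`) is the EDGE of the admissible range. It is the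
steady shadow of the circulation maximum principle `‖Γ(t)‖_∞ ≤ ‖Γ₀‖_∞` of axisymmetric
Navier–Stokes (Hou, §1 p. 3: "the total circulation satisfies an important conservation property";
for `n > 3` the zeroth-order coefficient `(6−2n)/ξ² < 0` only helps).

## Reading note on the source

Hou (§3, p. 11) prints the rescaled `Γ̃`-equation with "`c_Γ = c_u + 2c_lr = 2(c_lr − c_lz)`" and
displays the STEADY `Γ̃`-equation without a `c_ΓΓ̃` term; the second equality is `ĉ_lz = ½` in
disguise (`c_u = −2c_lz`), i.e. the circulation-conservation expectation "`c_l → 1/2`" of the same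
page, whereas the reported steady state has `ĉ_l = 0.5233`, `c_Γ = (2ĉ_l − 1)κ ≠ 0`. The tree's
predicate keeps general `(c_l, c_u)` (it is stated through the `ũ₁`-equation, where no such choice is
made), and so does this file: `c_Γ = c_u + 2c_l` throughout.

## WHAT THIS IS NOT

Nothing here asserts existence of a nontrivial profile, let alone anything about Navier–Stokes
blow-up: these are a-priori sign constraints on the exponents of HYPOTHETICAL smooth solutions of a
MODEL profile system (real dimension parameter `n`, solution-dependent viscosity law). The `n = 3`
strict inequality (strong maximum principle / Hopf lemma) is not proved.

## Mathlib / tree search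

Tree: `HouSelfSimilarProfile`, `HouScalingExponents.{kappa, hat, kappa_eq_neg_cu}`
(`HouTwoScaleRescaling.lean`); the slice calculus `derivR_slice`, `derivR_derivR_slice`,
`derivR_sq_mul`, `derivR_derivR_sq_mul`, `derivZ_sq_mul`, `derivZ_derivZ_sq_mul`,
`contDiff_slice_fst/snd` and `GeneralizedAxisymNS.circulation_eq_iff` (`GeneralizedAxisymNS.lean`);
`IsLocalMax.deriv_deriv_nonpos` exists in `ParabolicComparison.lean` (re-proved privately here in
eight lines to keep the imports light). Mathlib: `isLocalMin_of_deriv_deriv_pos`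
(`DerivativeTest`), `IsLocalMax.comp_continuous`, `IsLocalExtr.deriv_eq_zero`,
`Continuous.exists_forall_ge'` (`Topology.Order.Compact`), `IsMaxOn.isLocalMax`, `fderiv_neg`.
-/

noncomputable section

open Set Filter
open scoped Topology ContDiff

namespace Literature.Analysis.FluidPDE

/-! ### One- and two-variable second-derivative tests at a local maximum (private helpers) -/

/-- If `φ` has a local maximum at `a` and is continuous there, then `φ''(a) ≤ 0` (else the
second-derivative test makes `a` a local minimum too, `φ` is locally constant and `φ''(a) = 0`).
[folklore] -/
private theorem deriv_deriv_nonpos_of_isLocalMax' {φ : ℝ → ℝ} {a : ℝ} (h : IsLocalMax φ a)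
    (hc : ContinuousAt φ a) : deriv (deriv φ) a ≤ 0 := by
  by_contra hpos
  rw [not_le] at hpos
  have hmin : IsLocalMin φ a := isLocalMin_of_deriv_deriv_pos hpos h.deriv_eq_zero hc
  have heq : φ =ᶠ[𝓝 a] fun _ => φ a := (h.and hmin).mono fun s hs => le_antisymm hs.1 hs.2
  have h2 : deriv (deriv φ) a = deriv (deriv fun _ : ℝ => φ a) a := (heq.deriv).deriv_eq
  rw [h2] at hpos
  simp at hpos

variable {G : ℝ × ℝ → ℝ}

/-- At a local extremum of a smooth profile the radial partial derivative vanishes. [folklore] -/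
private theorem derivR_eq_zero_of_isLocalExtr (hG : ContDiff ℝ ∞ G) {q : ℝ × ℝ}
    (h : IsLocalExtr G q) : derivR G q = 0 := by
  obtain ⟨r, z⟩ := q
  rw [derivR_slice hG]
  have h1 : IsLocalExtr (G ∘ fun s : ℝ => ((s, z) : ℝ × ℝ)) r :=
    IsLocalExtr.comp_continuous (g := fun s : ℝ => ((s, z) : ℝ × ℝ)) (b := r) h (by fun_prop)
  exact h1.deriv_eq_zero

/-- At a local extremum of a smooth profile the axial partial derivative vanishes. [folklore] -/
private theorem derivZ_eq_zero_of_isLocalExtr (hG : ContDiff ℝ ∞ G) {q : ℝ × ℝ}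
    (h : IsLocalExtr G q) : derivZ G q = 0 := by
  obtain ⟨r, z⟩ := q
  rw [derivZ_slice hG]
  have h1 : IsLocalExtr (G ∘ fun s : ℝ => ((r, s) : ℝ × ℝ)) z :=
    IsLocalExtr.comp_continuous (g := fun s : ℝ => ((r, s) : ℝ × ℝ)) (b := z) h (by fun_prop)
  exact h1.deriv_eq_zero

/-- At a local maximum of a smooth profile `∂ᵣ∂ᵣG ≤ 0`. [folklore] -/
private theorem derivR_derivR_nonpos_of_isLocalMax (hG : ContDiff ℝ ∞ G) {q : ℝ × ℝ}
    (h : IsLocalMax G q) : derivR (derivR G) q ≤ 0 := by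
  obtain ⟨r, z⟩ := q
  rw [derivR_derivR_slice hG]
  have h1 : IsLocalMax (G ∘ fun s : ℝ => ((s, z) : ℝ × ℝ)) r :=
    IsLocalMax.comp_continuous (g := fun s : ℝ => ((s, z) : ℝ × ℝ)) (b := r) h (by fun_prop)
  exact deriv_deriv_nonpos_of_isLocalMax' h1 (contDiff_slice_fst hG z).continuous.continuousAt

/-- At a local maximum of a smooth profile `∂_z∂_zG ≤ 0`. [folklore] -/
private theorem derivZ_derivZ_nonpos_of_isLocalMax (hG : ContDiff ℝ ∞ G) {q : ℝ × ℝ}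
    (h : IsLocalMax G q) : derivZ (derivZ G) q ≤ 0 := by
  obtain ⟨r, z⟩ := q
  rw [derivZ_derivZ_slice hG]
  have h1 : IsLocalMax (G ∘ fun s : ℝ => ((r, s) : ℝ × ℝ)) z :=
    IsLocalMax.comp_continuous (g := fun s : ℝ => ((r, s) : ℝ × ℝ)) (b := z) h (by fun_prop)
  exact deriv_deriv_nonpos_of_isLocalMax' h1 (contDiff_slice_snd hG r).continuous.continuousAt

/-- `∂ᵣ(−G) = −∂ᵣG` (no differentiability needed: Mathlib's `fderiv_fun_neg`). [folklore] -/
private theorem derivR_neg (G : ℝ × ℝ → ℝ) : derivR (fun p => -G p) = fun p => -derivR G p := by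
  funext p
  simp [derivR, fderiv_fun_neg]

/-- `∂_z(−G) = −∂_zG`. [folklore] -/
private theorem derivZ_neg (G : ℝ × ℝ → ℝ) : derivZ (fun p => -G p) = fun p => -derivZ G p := by
  funext p
  simp [derivZ, fderiv_fun_neg]

namespace HouSelfSimilarProfile

variable {n ν₀ cl cu : ℝ} {U Ω Ψ : ℝ × ℝ → ℝ}

/-! ### Sign symmetry of the swirl component -/

/-- **`ũ₁ ↦ −ũ₁` symmetry.** If `(U, Ω, Ψ)` solves Hou's self-similar profile system, so does
`(−U, Ω, Ψ)`: the `ũ₁`-equation is linear homogeneous in `ũ₁` for given `ψ̃₁`, the vorticity source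
`(ũ₁²)_η` is unchanged, and `−L_nΨ = Ω` does not involve `ũ₁` (arXiv:2405.10916 §3, structure of the
displayed steady system). [cite: Hou2026, §3 (self-similar equations of the steady state)] -/
theorem neg (hP : HouSelfSimilarProfile n ν₀ cl cu U Ω Ψ) :
    HouSelfSimilarProfile n ν₀ cl cu (fun p => -U p) Ω Ψ := by
  refine ⟨hP.smooth_U.neg, hP.smooth_Ω, hP.smooth_Ψ, fun ξ η => by simp [hP.even_U ξ η],
    hP.even_Ω, hP.even_Ψ, ?_, ?_, hP.stream_eq⟩
  · intro q hq
    have h := hP.swirl_eq q hq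
    have hRR : derivR (derivR fun p => -U p) q = -derivR (derivR U) q := by
      rw [derivR_neg, derivR_neg]
    have hZZ : derivZ (derivZ fun p => -U p) q = -derivZ (derivZ U) q := by
      rw [derivZ_neg, derivZ_neg]
    simp only [GeneralizedAxisymNS.lap] at h ⊢
    rw [hRR, hZZ, derivR_neg, derivZ_neg]
    linear_combination (-1 : ℝ) * h
  · intro q hq
    have h := hP.vorticity_eq q hq
    have hsq : (fun q' : ℝ × ℝ => (-U q') ^ 2) = fun q' => U q' ^ 2 := funext fun q' => neg_sq (U q')
    rw [hsq]
    exact h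

/-! ### The steady circulation equation -/

/-- **The steady rescaled circulation equation.** For a profile and `ξ > 0`, `Γ̃ := ξ² ũ₁` satisfies
`c_l ξ Γ̃_ξ + c_l η Γ̃_η + ũ^ξ Γ̃_ξ + ũ^η Γ̃_η = c_Γ Γ̃ + ν₀ (Γ̃_ξξ + ((n−4)/ξ) Γ̃_ξ + ((6−2n)/ξ²) Γ̃ + Γ̃_ηη)`
with `c_Γ = c_u + 2c_l` (arXiv:2405.10916 §3: "`c_Γ = c_u + 2c_lr`" and the operator `Δ̃`; §1 (1.1)
for the unrescaled equation) — the `ũ₁`-equation times `ξ²`, the stretching `2ũ₁ψ̃₁,η` cancelling the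
radial transport of `ξ²`. [cite: Hou2026, §3 (rescaled Γ̃-equation, c_Γ = c_u + 2c_lr)] -/
theorem circulation_eq (hP : HouSelfSimilarProfile n ν₀ cl cu U Ω Ψ) {q : ℝ × ℝ} (hq : 0 < q.1) :
    cl * q.1 * derivR (fun p : ℝ × ℝ => p.1 ^ 2 * U p) q +
          cl * q.2 * derivZ (fun p : ℝ × ℝ => p.1 ^ 2 * U p) q +
          GeneralizedAxisymNS.radialVel Ψ q * derivR (fun p : ℝ × ℝ => p.1 ^ 2 * U p) q +
          GeneralizedAxisymNS.axialVel n Ψ q * derivZ (fun p : ℝ × ℝ => p.1 ^ 2 * U p) q =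
      (cu + 2 * cl) * (q.1 ^ 2 * U q) +
        ν₀ * (derivR (derivR fun p : ℝ × ℝ => p.1 ^ 2 * U p) q +
          (n - 4) / q.1 * derivR (fun p : ℝ × ℝ => p.1 ^ 2 * U p) q +
          (6 - 2 * n) / q.1 ^ 2 * (q.1 ^ 2 * U q) +
          derivZ (derivZ fun p : ℝ × ℝ => p.1 ^ 2 * U p) q) := by
  have hU := hP.smooth_U
  have hsw := hP.swirl_eq q hq
  rw [derivR_sq_mul hU, derivZ_sq_mul hU, derivR_derivR_sq_mul hU, derivZ_derivZ_sq_mul hU]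
  simp only [GeneralizedAxisymNS.lap, GeneralizedAxisymNS.radialVel,
    GeneralizedAxisymNS.axialVel] at hsw ⊢
  have hr : q.1 ≠ 0 := hq.ne'
  set r := q.1
  set u := U q
  set R := derivR U q
  set Z := derivZ U q
  set RR := derivR (derivR U) q
  set ZZ := derivZ (derivZ U) q
  set P := Ψ q
  set PR := derivR Ψ q
  set PZ := derivZ Ψ q
  have e1 : (cl * r * (2 * r * u + r ^ 2 * R) + cl * q.2 * (r ^ 2 * Z) +
          -(r * PZ) * (2 * r * u + r ^ 2 * R) + ((n - 1) * P + r * PR) * (r ^ 2 * Z)) -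
        ((cu + 2 * cl) * (r ^ 2 * u) +
          ν₀ * (2 * u + 4 * r * R + r ^ 2 * RR + (n - 4) / r * (2 * r * u + r ^ 2 * R) +
            (6 - 2 * n) / r ^ 2 * (r ^ 2 * u) + r ^ 2 * ZZ)) =
      r ^ 2 * ((cl * r * R + cl * q.2 * Z + -(r * PZ) * R + ((n - 1) * P + r * PR) * Z) -
        (cu * u + 2 * u * PZ + ν₀ * (RR + n / r * R + ZZ))) := by
    field_simp
    ring
  rw [← sub_eq_zero, e1, hsw, sub_self, mul_zero]

/-! ### The maximum principle at an interior extremum of `Γ̃` -/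

/-- **Maximum principle, pointwise.** At a point `q`, `ξ = q.1 > 0`, where `Γ̃ = ξ²ũ₁` has a local
maximum: `(2n − 6) ν₀ ũ₁(q) ≤ c_Γ Γ̃(q)`, `c_Γ = c_u + 2c_l` (for `ν₀ ≥ 0`): evaluate `circulation_eq`
at `q`, where `∇Γ̃ = 0`, `Γ̃_ξξ ≤ 0`, `Γ̃_ηη ≤ 0`. [cite: Hou2026, §3 (rescaled Γ̃-equation, c_Γ = c_u + 2c_lr)] -/
theorem mul_circulation_ge_of_isLocalMax (hP : HouSelfSimilarProfile n ν₀ cl cu U Ω Ψ)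
    (hν : 0 ≤ ν₀) {q : ℝ × ℝ} (hq : 0 < q.1)
    (hmax : IsLocalMax (fun p : ℝ × ℝ => p.1 ^ 2 * U p) q) :
    (2 * n - 6) * ν₀ * U q ≤ (cu + 2 * cl) * (q.1 ^ 2 * U q) := by
  have hΓ : ContDiff ℝ ∞ (fun p : ℝ × ℝ => p.1 ^ 2 * U p) := (contDiff_fst.pow 2).mul hP.smooth_U
  have hce := hP.circulation_eq hq
  have hR0 := derivR_eq_zero_of_isLocalExtr hΓ (Or.inr hmax : IsLocalExtr _ q)
  have hZ0 := derivZ_eq_zero_of_isLocalExtr hΓ (Or.inr hmax : IsLocalExtr _ q)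
  have hRR := derivR_derivR_nonpos_of_isLocalMax hΓ hmax
  have hZZ := derivZ_derivZ_nonpos_of_isLocalMax hΓ hmax
  have hr : q.1 ≠ 0 := hq.ne'
  have hdiv : (6 - 2 * n) / q.1 ^ 2 * (q.1 ^ 2 * U q) = (6 - 2 * n) * U q := by
    field_simp
  rw [hR0, hZ0, hdiv] at hce
  simp only [mul_zero, add_zero] at hce
  nlinarith [mul_nonpos_of_nonneg_of_nonpos hν hRR, mul_nonpos_of_nonneg_of_nonpos hν hZZ]

/-- **Minimum principle, pointwise** (the `ũ₁ ↦ −ũ₁` mirror of `mul_circulation_ge_of_isLocalMax`):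
at an interior local minimum of `Γ̃ = ξ²ũ₁`, `c_Γ Γ̃(q) ≤ (2n − 6) ν₀ ũ₁(q)`.
[cite: Hou2026, §3 (rescaled Γ̃-equation, c_Γ = c_u + 2c_lr)] -/
theorem mul_circulation_le_of_isLocalMin (hP : HouSelfSimilarProfile n ν₀ cl cu U Ω Ψ)
    (hν : 0 ≤ ν₀) {q : ℝ × ℝ} (hq : 0 < q.1)
    (hmin : IsLocalMin (fun p : ℝ × ℝ => p.1 ^ 2 * U p) q) :
    (cu + 2 * cl) * (q.1 ^ 2 * U q) ≤ (2 * n - 6) * ν₀ * U q := by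
  have hmax : IsLocalMax (fun p : ℝ × ℝ => p.1 ^ 2 * (fun p' : ℝ × ℝ => -U p') p) q := by
    have := hmin.neg
    simpa [mul_neg] using this
  have h := mul_circulation_ge_of_isLocalMax hP.neg hν hq hmax
  simp only [mul_neg] at h
  linarith

/-- At a POSITIVE interior local maximum of `Γ̃ = ξ²ũ₁` the circulation exponent is bounded below:
`(2n − 6) ν₀ / ξ² ≤ c_u + 2c_l`. [cite: Hou2026, §3 (rescaled Γ̃-equation, c_Γ = c_u + 2c_lr)] -/
theorem circulationExponent_ge_of_isLocalMax (hP : HouSelfSimilarProfile n ν₀ cl cu U Ω Ψ)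
    (hν : 0 ≤ ν₀) {q : ℝ × ℝ} (hq : 0 < q.1)
    (hmax : IsLocalMax (fun p : ℝ × ℝ => p.1 ^ 2 * U p) q) (hU : 0 < U q) :
    (2 * n - 6) * ν₀ / q.1 ^ 2 ≤ cu + 2 * cl := by
  have h := mul_circulation_ge_of_isLocalMax hP hν hq hmax
  have hr2 : 0 < q.1 ^ 2 := by positivity
  rw [div_le_iff₀ hr2]
  nlinarith

/-- At a NEGATIVE interior local minimum of `Γ̃ = ξ²ũ₁`: `(2n − 6) ν₀ / ξ² ≤ c_u + 2c_l`.
[cite: Hou2026, §3 (rescaled Γ̃-equation, c_Γ = c_u + 2c_lr)] -/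
theorem circulationExponent_ge_of_isLocalMin (hP : HouSelfSimilarProfile n ν₀ cl cu U Ω Ψ)
    (hν : 0 ≤ ν₀) {q : ℝ × ℝ} (hq : 0 < q.1)
    (hmin : IsLocalMin (fun p : ℝ × ℝ => p.1 ^ 2 * U p) q) (hU : U q < 0) :
    (2 * n - 6) * ν₀ / q.1 ^ 2 ≤ cu + 2 * cl := by
  have h := mul_circulation_le_of_isLocalMin hP hν hq hmin
  have hr2 : 0 < q.1 ^ 2 := by positivity
  rw [div_le_iff₀ hr2]
  nlinarith

/-- **`c_Γ ≥ 0` for `n ≥ 3`** at a positive interior local maximum of the circulation.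
[cite: Hou2026, §3 (rescaled Γ̃-equation, c_Γ = c_u + 2c_lr)] -/
theorem circulationExponent_nonneg_of_isLocalMax (hP : HouSelfSimilarProfile n ν₀ cl cu U Ω Ψ)
    (hn : 3 ≤ n) (hν : 0 ≤ ν₀) {q : ℝ × ℝ} (hq : 0 < q.1)
    (hmax : IsLocalMax (fun p : ℝ × ℝ => p.1 ^ 2 * U p) q) (hU : 0 < U q) :
    0 ≤ cu + 2 * cl := by
  refine le_trans ?_ (circulationExponent_ge_of_isLocalMax hP hν hq hmax hU)
  have : 0 ≤ 2 * n - 6 := by linarith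
  positivity

/-- **`c_Γ > 0` for `n > 3`, `ν₀ > 0`** at a positive interior local maximum of the circulation
(the zeroth-order coefficient `(6−2n)/ξ² < 0` of `Δ̃` makes the inequality strict).
[cite: Hou2026, §3 (rescaled Γ̃-equation, c_Γ = c_u + 2c_lr)] -/
theorem circulationExponent_pos_of_isLocalMax (hP : HouSelfSimilarProfile n ν₀ cl cu U Ω Ψ)
    (hn : 3 < n) (hν : 0 < ν₀) {q : ℝ × ℝ} (hq : 0 < q.1)
    (hmax : IsLocalMax (fun p : ℝ × ℝ => p.1 ^ 2 * U p) q) (hU : 0 < U q) :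
    0 < cu + 2 * cl := by
  refine lt_of_lt_of_le ?_ (circulationExponent_ge_of_isLocalMax hP hν.le hq hmax hU)
  have : 0 < 2 * n - 6 := by linarith
  positivity

/-! ### Global form: decaying circulation forces `c_Γ ≥ 0` -/

/-- Positive case of the global maximum principle: a profile whose circulation `Γ̃ = ξ²U` tends to
`0` at infinity and is positive somewhere attains a positive maximum at an interior point of the
right half-plane (it vanishes on the axis and is even in `ξ`), whence the pointwise bound.
[cite: Hou2026, §3 (rescaled Γ̃-equation, c_Γ = c_u + 2c_lr)] -/
theorem circulationExponent_ge_of_tendsto_zero_of_pos (hP : HouSelfSimilarProfile n ν₀ cl cu U Ω Ψ)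
    (hν : 0 ≤ ν₀)
    (hdecay : Tendsto (fun p : ℝ × ℝ => p.1 ^ 2 * U p) (cocompact (ℝ × ℝ)) (𝓝 0))
    {q₀ : ℝ × ℝ} (hpos : 0 < q₀.1 ^ 2 * U q₀) :
    ∃ q : ℝ × ℝ, 0 < q.1 ∧ 0 < U q ∧ IsLocalMax (fun p : ℝ × ℝ => p.1 ^ 2 * U p) q ∧
      (2 * n - 6) * ν₀ / q.1 ^ 2 ≤ cu + 2 * cl := by
  set Γ : ℝ × ℝ → ℝ := fun p => p.1 ^ 2 * U p with hΓ
  have hΓc : Continuous Γ := ((contDiff_fst.pow 2).mul hP.smooth_U).continuous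
  have heven : ∀ p : ℝ × ℝ, Γ (-p.1, p.2) = Γ p := fun p => by
    simp only [hΓ, neg_sq, hP.even_U p.1 p.2]
  have hev : ∀ᶠ p in cocompact (ℝ × ℝ), Γ p ≤ Γ q₀ :=
    (hdecay.eventually (Iio_mem_nhds hpos)).mono fun p hp => hp.le
  obtain ⟨m, hm⟩ := hΓc.exists_forall_ge' q₀ hev
  have hmpos : 0 < Γ m := hpos.trans_le (hm q₀)
  have hm1 : m.1 ≠ 0 := by
    intro h0
    have : Γ m = 0 := by simp [hΓ, h0]
    exact hmpos.ne' this
  -- a maximiser with positive first coordinate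
  obtain ⟨q, hq1, hqmax, hqpos⟩ : ∃ q : ℝ × ℝ, 0 < q.1 ∧ (∀ y, Γ y ≤ Γ q) ∧ 0 < Γ q := by
    rcases hm1.lt_or_gt with hlt | hgt
    · refine ⟨(-m.1, m.2), by simpa using hlt, fun y => ?_, ?_⟩
      · rw [heven m]; exact hm y
      · rw [heven m]; exact hmpos
    · exact ⟨m, hgt, hm, hmpos⟩
  have hloc : IsLocalMax Γ q := (isMaxOn_iff.2 fun y _ => hqmax y).isLocalMax univ_mem
  have hUq : 0 < U q := pos_of_mul_pos_right (hqpos : 0 < q.1 ^ 2 * U q) (by positivity)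
  exact ⟨q, hq1, hUq, hloc, circulationExponent_ge_of_isLocalMax hP hν hq1 hloc hUq⟩

/-- **Global maximum principle: `c_Γ = c_u + 2c_l ≥ 0`** (`n ≥ 3`, `ν₀ ≥ 0`) for every profile whose
circulation `Γ̃ = ξ² ũ₁` decays at infinity and whose swirl `ũ₁` is not identically zero off the
axis — the steady shadow of circulation conservation (arXiv:2405.10916 §1 p. 3, §3).
[cite: Hou2026, §3 (rescaled Γ̃-equation, c_Γ = c_u + 2c_lr)] -/
theorem circulationExponent_nonneg_of_tendsto_zero (hP : HouSelfSimilarProfile n ν₀ cl cu U Ω Ψ)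
    (hn : 3 ≤ n) (hν : 0 ≤ ν₀)
    (hdecay : Tendsto (fun p : ℝ × ℝ => p.1 ^ 2 * U p) (cocompact (ℝ × ℝ)) (𝓝 0))
    (hne : ∃ q : ℝ × ℝ, q.1 ≠ 0 ∧ U q ≠ 0) : 0 ≤ cu + 2 * cl := by
  obtain ⟨q₀, hq₀, hU₀⟩ := hne
  have h26 : 0 ≤ 2 * n - 6 := by linarith
  have hsq : 0 < q₀.1 ^ 2 := by positivity
  rcases hU₀.lt_or_gt with hneg | hpos
  · -- negative somewhere: apply the positive case to `−U`
    have hdecay' : Tendsto (fun p : ℝ × ℝ => p.1 ^ 2 * (fun p' : ℝ × ℝ => -U p') p)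
        (cocompact (ℝ × ℝ)) (𝓝 0) := by
      simpa [mul_neg] using hdecay.neg
    have hpos' : 0 < q₀.1 ^ 2 * (fun p' : ℝ × ℝ => -U p') q₀ := by
      simp only [mul_neg]; nlinarith
    obtain ⟨q, hq1, -, -, hb⟩ := circulationExponent_ge_of_tendsto_zero_of_pos hP.neg hν hdecay' hpos'
    exact le_trans (by positivity) hb
  · have hpos' : 0 < q₀.1 ^ 2 * U q₀ := mul_pos hsq hpos
    obtain ⟨q, hq1, -, -, hb⟩ := circulationExponent_ge_of_tendsto_zero_of_pos hP hν hdecay hpos'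
    exact le_trans (by positivity) hb

/-- **Strict global form for `n > 3`, `ν₀ > 0`: `c_u + 2c_l > 0`** under the same hypotheses.
[cite: Hou2026, §3 (rescaled Γ̃-equation, c_Γ = c_u + 2c_lr)] -/
theorem circulationExponent_pos_of_tendsto_zero (hP : HouSelfSimilarProfile n ν₀ cl cu U Ω Ψ)
    (hn : 3 < n) (hν : 0 < ν₀)
    (hdecay : Tendsto (fun p : ℝ × ℝ => p.1 ^ 2 * U p) (cocompact (ℝ × ℝ)) (𝓝 0))
    (hne : ∃ q : ℝ × ℝ, q.1 ≠ 0 ∧ U q ≠ 0) : 0 < cu + 2 * cl := by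
  obtain ⟨q₀, hq₀, hU₀⟩ := hne
  have h26 : 0 < 2 * n - 6 := by linarith
  have hsq : 0 < q₀.1 ^ 2 := by positivity
  rcases hU₀.lt_or_gt with hneg | hpos
  · have hdecay' : Tendsto (fun p : ℝ × ℝ => p.1 ^ 2 * (fun p' : ℝ × ℝ => -U p') p)
        (cocompact (ℝ × ℝ)) (𝓝 0) := by
      simpa [mul_neg] using hdecay.neg
    have hpos' : 0 < q₀.1 ^ 2 * (fun p' : ℝ × ℝ => -U p') q₀ := by
      simp only [mul_neg]; nlinarith
    obtain ⟨q, hq1, -, -, hb⟩ :=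
      circulationExponent_ge_of_tendsto_zero_of_pos hP.neg hν.le hdecay' hpos'
    exact lt_of_lt_of_le (by positivity) hb
  · have hpos' : 0 < q₀.1 ^ 2 * U q₀ := mul_pos hsq hpos
    obtain ⟨q, hq1, -, -, hb⟩ := circulationExponent_ge_of_tendsto_zero_of_pos hP hν.le hdecay hpos'
    exact lt_of_lt_of_le (by positivity) hb

/-- **Contrapositive at the parabolic corner** (`n > 3`): a nontrivial profile with `c_u + 2c_l ≤ 0`
— in particular one at the Navier–Stokes gauge `ĉ_l = ½`, i.e. `c_u + 2c_l = 0` — cannot have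
circulation decaying at infinity. [cite: Hou2026, §3 (rescaled Γ̃-equation, c_Γ = c_u + 2c_lr)] -/
theorem not_tendsto_circulation_zero_of_circulationExponent_nonpos
    (hP : HouSelfSimilarProfile n ν₀ cl cu U Ω Ψ) (hn : 3 < n) (hν : 0 < ν₀)
    (hc : cu + 2 * cl ≤ 0) (hne : ∃ q : ℝ × ℝ, q.1 ≠ 0 ∧ U q ≠ 0) :
    ¬ Tendsto (fun p : ℝ × ℝ => p.1 ^ 2 * U p) (cocompact (ℝ × ℝ)) (𝓝 0) := fun hdecay =>
  (circulationExponent_pos_of_tendsto_zero hP hn hν hdecay hne).not_ge hc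

end HouSelfSimilarProfile

/-! ### The exponent dictionary: `c_Γ ≥ 0` is `ĉ_l ≥ ½` on the blow-up side -/

/-- On the blow-up side `κ = −c_u > 0`, `0 ≤ c_u + 2c_l` reads `½ ≤ ĉ_l = c_l/κ`: the normalized
length exponent of a profile with decaying circulation is at least the parabolic value `½`
(arXiv:2405.10916 §1.1: `ν = ν₀(T−t)^{2c_l−1}` is constant iff `ĉ_l = ½`; cf.
`HouScalingExponents.physicalViscosity_eq_rpow`). [cite: Hou2026, §1.1 (ν = ν₀(T−t)^{2c_l−1})] -/
theorem half_le_collapseExponent {cl cu : ℝ} (h : 0 ≤ cu + 2 * cl) (hκ : 0 < -cu) :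
    1 / 2 ≤ cl / (-cu) := by
  rw [le_div_iff₀ hκ]
  linarith

/-- The same in the vocabulary of `HouScalingExponents` (one-scale regime `c_lr = c_lz = c_l`,
`κ = c_lz − c_ψ = −c_u`): `0 ≤ c_u + 2c_lz` and `κ > 0` give `ĉ_lz = c_lz/κ ≥ ½`, hence the viscosity-law
exponent `2ĉ_lz − 1 ≥ 0` of `physicalViscosity_eq_rpow`. [cite: Hou2026, §1.1 (ν = ν₀(T−t)^{2c_l−1})] -/
theorem HouScalingExponents.half_le_hat_clz (e : HouScalingExponents) (h : 0 ≤ e.cu + 2 * e.clz)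
    (hκ : 0 < e.kappa) : 1 / 2 ≤ e.hat e.clz := by
  rw [HouScalingExponents.hat, le_div_iff₀ hκ]
  have := e.kappa_eq_neg_cu
  linarith

end Literature.Analysis.FluidPDE
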